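import Literature.NumberTheory.Transcendental.ManyCurveStd
import Literature.NumberTheory.Transcendental.UnivExtAlgPointsDivision
import HarnessLib

/-!
# Crux `RealOnePeriodRelations` (stmt-KontsevichZagierPeriods-10042),
# line `nash-retraction-thin-strip`, stub `stub_famPointsAlg`:
# point arithmetic of the family standard models at general algebraic points

The Semistability Theorem for the FAMILY standard models `M = 𝔾ₘ^β × P`
(`Literature/NumberTheory/Transcendental/ManyCurveStd.lean`: `GaGmEFam.Std.ker`, `Alg`, `AlgTors`;
the block `b : γ` carries the lattice `Λ_{cls b} = (L (cls b)).lattice`) at GENERAL algebraic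
points needs three elementary facts about points, which the tree has for ONE lattice
(`GaGmE.Std.inv_natCast_smul_mem_Alg`, `GaGmE.Std.mem_AlgTors_of_smul_mem_ker` in
`SemistabilityStdOfEngine.lean`, `GaGmE.Std.exists_reduced_multiple` in `BakerNumericsG.lean`).
This file ports them block by block, each block with the invariants of its own class:

* `stub_famPointsAlg` — **`Alg(M)` is stable under division**: if `exp_M(w)` is algebraic then so
  is `exp_M(w/m)`, `m ≥ 1` (roots of algebraic numbers in `𝔾ₘ^β`; division points of `ℚ̄`-points
  of `E_{cls b}♮` are `ℚ̄`-points, `PeriodPair.IsUnivExtAlgPoint.div_nat`; `s''/m ∈ ℚ̄^δ`);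
* `mem_AlgTors_of_smul_mem_ker_fam` — an algebraic point with a multiple `r·w ∈ ker(exp_M)`,
  `r ≥ 1`, has torsion abelian part;
* `exists_reduced_multiple_fam` — every `w ∈ Lie M_ℂ` has a multiple `N·w`, `N ≥ 1`, each of whose
  `E`-coordinates is a vector of `Λ_{cls b}` or has no torsion modulo `Λ_{cls b}`.

References: A. Baker, G. Wüstholz, *Logarithmic Forms and Diophantine Geometry*, New Math.
Monogr. 9, CUP 2007, Thm. 6.15, §6.8 (p. 117: division points). [BakerWustholz2007]
-/

noncomputable section

open Complex Module Submodule

open Literature.NumberTheory.Transcendental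

namespace Summit.KontsevichZagierPeriods.SymplecticScissors.RealOnePeriodRelations.MultiEllLayer

open GaGmE.Std (iy iz is)

/-- **`Alg(M)` is stable under division** for the family standard models `M = 𝔾ₘ^β × P`: if
`exp_M(w)` is algebraic then so is `exp_M(w/m)` (`m ≥ 1`) — roots of algebraic numbers are
algebraic, the division points of `ℚ̄`-points of `E_{cls b}♮` are `ℚ̄`-points
(`PeriodPair.IsUnivExtAlgPoint.div_nat`, block by block with the invariants of the class
`cls b`), and `s''/m ∈ ℚ̄^δ`. The family twin of `GaGmE.Std.inv_natCast_smul_mem_Alg`.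
[cite: BakerWustholz2007, §6.8 (p. 117)] -/
theorem stub_famPointsAlg {J : Type} [Fintype J] [DecidableEq J] {L : J → PeriodPair}
    (hL : ∀ i, IsAlgebraic ℚ (L i).g₂ ∧ IsAlgebraic ℚ (L i).g₃)
    {β γ δ : Type} [Fintype β] [Fintype γ] [Fintype δ] {cls : γ → J} {κM : δ → γ → GaGmE.Kbar}
    {w : β ⊕ (γ ⊕ δ) → ℂ} (hw : w ∈ GaGmEFam.Std.Alg L cls κM) {m : ℕ} (hm : 0 < m) :
    ((m : ℂ)⁻¹ • w) ∈ GaGmEFam.Std.Alg L cls κM := by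
  -- adapted from `GaGmE.Std.inv_natCast_smul_mem_Alg` (`SemistabilityStdOfEngine.lean`)
  obtain ⟨hy, t', hzt, hs⟩ := hw
  have hminv : IsAlgebraic ℚ ((m : ℂ)⁻¹) := (isAlgebraic_nat m).inv
  refine ⟨fun j => ?_, fun b => (m : ℂ)⁻¹ * t' b, fun b => ?_, fun e => ?_⟩
  · refine IsAlgebraic.of_pow hm ?_
    have e : cexp (((m : ℂ)⁻¹ • w) (iy j)) ^ m = cexp (w (iy j)) := by
      rw [← Complex.exp_nat_mul]
      simp only [Pi.smul_apply, smul_eq_mul]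
      congr 1
      field_simp [(show (m : ℂ) ≠ 0 by exact_mod_cast hm.ne')]
    rw [e]; exact hy j
  · have h := (hzt b).div_nat (hL (cls b)).1 (hL (cls b)).2 (n := m) hm.ne'
    simp only [Pi.smul_apply, smul_eq_mul]
    rw [div_eq_inv_mul, div_eq_inv_mul] at h
    exact h
  · have e1 : ((m : ℂ)⁻¹ • w) (is e) - ∑ b, (κM e b : ℂ) * ((m : ℂ)⁻¹ * t' b) =
        (m : ℂ)⁻¹ * (w (is e) - ∑ b, (κM e b : ℂ) * t' b) := by
      simp only [Pi.smul_apply, smul_eq_mul, Finset.mul_sum, mul_sub]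
      congr 1
      exact Finset.sum_congr rfl fun b _ => by ring
    rw [e1]; exact hminv.mul (hs e)

/-- **An algebraic point with a multiple in `ker(exp_M)` has torsion abelian part**: if
`exp_M(w)` is algebraic and `r·w ∈ ker(exp_M)` for some `r ≥ 1`, then `w ∈ GaGmEFam.Std.AlgTors`
(block `b`: `r·z'_b ∈ Λ_{cls b}`). The family twin of `GaGmE.Std.mem_AlgTors_of_smul_mem_ker`.
[folklore] -/
theorem mem_AlgTors_of_smul_mem_ker_fam {J : Type} [Fintype J] [DecidableEq J] {L : J → PeriodPair}
    {β γ δ : Type} [Fintype β] [Fintype γ] [Fintype δ] {cls : γ → J} {κM : δ → γ → GaGmE.Kbar}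
    {w : β ⊕ (γ ⊕ δ) → ℂ} (hw : w ∈ GaGmEFam.Std.Alg L cls κM) {r : ℕ} (hr : 0 < r)
    (hrw : ((r : ℂ) • w) ∈ GaGmEFam.Std.ker L cls κM) : w ∈ GaGmEFam.Std.AlgTors L cls κM := by
  -- adapted from `GaGmE.Std.mem_AlgTors_of_smul_mem_ker` (`SemistabilityStdOfEngine.lean`)
  obtain ⟨-, m, n, hz, -⟩ := hrw
  refine ⟨hw, fun b => ⟨r, hr, ?_⟩⟩
  have e : (r : ℂ) * w (iz b) = m b * (L (cls b)).ω₁ + n b * (L (cls b)).ω₂ := by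
    have := hz b
    simpa only [Pi.smul_apply, smul_eq_mul] using this
  rw [e]
  exact PeriodPair.mem_lattice.mpr ⟨m b, n b, rfl⟩

/-- **Reduced multiples, blockwise lattices.** Every `w ∈ Lie M_ℂ` has a multiple `N·w`, `N ≥ 1`,
each of whose `E`-coordinates `N z'_b` is a vector of `Λ_{cls b}` or has no torsion modulo
`Λ_{cls b}` (`s·(N z'_b) ∉ Λ_{cls b}` for all `s ≥ 1`): take `N` the product of the torsion
orders of the torsion coordinates. The family twin of `GaGmE.Std.exists_reduced_multiple`.
[folklore] -/
theorem exists_reduced_multiple_fam {J : Type} (L : J → PeriodPair) {β γ δ : Type} [Fintype γ]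
    (cls : γ → J) (w : β ⊕ (γ ⊕ δ) → ℂ) :
    ∃ N : ℕ, 0 < N ∧ ∀ b, ((N : ℂ) • w) (GaGmE.Std.iz b) ∈ (L (cls b)).lattice ∨
      ∀ s : ℕ, s ≠ 0 → (s : ℂ) * ((N : ℂ) • w) (GaGmE.Std.iz b) ∉ (L (cls b)).lattice := by
  -- adapted from `GaGmE.Std.exists_reduced_multiple` (`BakerNumericsG.lean`)
  classical
  -- per-coordinate torsion orders (`1` for a non-torsion coordinate)
  have hco : ∀ b, ∃ nb : ℕ, 0 < nb ∧
      ((∃ m : ℕ, m ≠ 0 ∧ (m : ℂ) * w (iz b) ∈ (L (cls b)).lattice) →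
        (nb : ℂ) * w (iz b) ∈ (L (cls b)).lattice) := by
    intro b
    by_cases h : ∃ m : ℕ, m ≠ 0 ∧ (m : ℂ) * w (iz b) ∈ (L (cls b)).lattice
    · obtain ⟨m, hm, hmem⟩ := h
      exact ⟨m, Nat.pos_of_ne_zero hm, fun _ => hmem⟩
    · exact ⟨1, one_pos, fun h' => absurd h' h⟩
  choose nb hnb hmem using hco
  refine ⟨∏ b, nb b, Finset.prod_pos fun b _ => hnb b, fun b => ?_⟩
  simp only [Pi.smul_apply, smul_eq_mul]
  by_cases h : ∃ m : ℕ, m ≠ 0 ∧ (m : ℂ) * w (iz b) ∈ (L (cls b)).lattice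
  · left
    rw [← Finset.mul_prod_erase Finset.univ nb (Finset.mem_univ b)]
    push_cast
    rw [mul_comm ((nb b : ℂ)), mul_assoc]
    have := (L (cls b)).lattice.smul_mem ((∏ b' ∈ Finset.univ.erase b, nb b' : ℕ) : ℤ) (hmem b h)
    simpa [zsmul_eq_mul] using this
  · right
    intro s hs hsm
    push Not at h
    apply h (s * ∏ b', nb b')
      (Nat.mul_ne_zero hs (Finset.prod_ne_zero_iff.mpr fun b' _ => (hnb b').ne'))
    push_cast
    rw [mul_assoc]
    exact_mod_cast hsm

end Summit.KontsevichZagierPeriods.SymplecticScissors.RealOnePeriodRelations.MultiEllLayer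

end
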